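import Summits.HubbardSuperconductivity.HubbardSuperconductivity.Theorems.AnisotropyChordFerroSideChordOfPieces
import Summits.HubbardSuperconductivity.HubbardSuperconductivity.Theorems.AnisotropyChordFerroSideChordEndpoints
import Summits.HubbardSuperconductivity.HubbardSuperconductivity.Theorems.AnisotropyChordFerroSideChordFour

/-!
# Route `AnisotropyChord`, crux `FerroSideChord` (stmt-HubbardSuperconductivity-19089): what remains
# after piece C — `FerroSideChord ⇐ FerroSideChordLarge ∧ FerroSideChordSmall`, and
# `FerroSideChord ⇐ FerroSideChordLarge ∧ (chord at M = 6) ∧ (chord at M = 8)`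

Bookkeeping for the range split (tenure D1, route rev 4) of the crux `FerroSideChord` after this
seat's files: the glue `FerroSideChordOfPieces` (stmt-23921, `ferroSideChordOfPieces_proof`) and
piece C `FerroSideChordEndpoints` (stmt-23920, `FerroSide.ferroSideChordEndpoints_proof`, continuity
in `Δ`) are PROVED, and the residual B `FerroSideChordSmall` (`M ∈ {4,6,8}`) holds at `M = 4`
(`FourTorus.ferroSideChord_four`, kernel-certified).  Hence:

* `ferroSideChord_of_large_small` — `FerroSideChordLarge → FerroSideChordSmall → FerroSideChord`;
* `ferroSideChordSmall_of_six_eight` — `FerroSideChordSmall` from the interior chord at `M = 6` and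
  at `M = 8` alone;
* `ferroSideChord_of_large_six_eight` — the crux from piece A (stmt-23918, even `M ≥ 10`,
  `Δ ∈ (0,1)`: the thermodynamic content, OPEN) and the two finite instances `M = 6`, `M = 8` on
  the open interval `Δ ∈ (0,1)` (OPEN; `M = 6` instrumentable numerically, no certificate yet).

WHAT THIS IS NOT: none of the remaining pieces is proved here; nothing here proves
superconductivity in the Hubbard model.  Pure logic; no definition is introduced.
-/

set_option linter.dupNamespace false

noncomputable section

open Matrix
open Literature.MathematicalPhysics.QuantumLattice Literature.Probability.LatticeModels
open Summit.HubbardSuperconductivity.HubbardSuperconductivity.Theses.AnisotropyChord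
open Summit.HubbardSuperconductivity.HubbardSuperconductivity.Theorems (ferroSideChordOfPieces_proof)
open Summit.HubbardSuperconductivity.HubbardSuperconductivity.Theorems.AnisotropyChord.FourTorus
  (ferroSideChord_four)

namespace Summit.HubbardSuperconductivity.HubbardSuperconductivity.Theorems.AnisotropyChord.FerroSide

/-- **`FerroSideChord ⇐ FerroSideChordLarge ∧ FerroSideChordSmall`** (piece C discharged by
`ferroSideChordEndpoints_proof`, glue `ferroSideChordOfPieces_proof`). [folklore] -/
theorem ferroSideChord_of_large_small (hA : FerroSideChordLarge) (hB : FerroSideChordSmall) :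
    FerroSideChord :=
  (show FerroSideChordLarge → FerroSideChordSmall → FerroSideChordEndpoints → FerroSideChord from
    ferroSideChordOfPieces_proof) hA hB ferroSideChordEndpoints_proof

/-- The interior chord statement at one side length `M` (the body of `FerroSideChordSmall` /
`FerroSideChordLarge` at fixed `M`): for every `Δ ∈ (0,1)` and every normalised `S^z_tot = 0` sector
ground state `ψ` of `H_M(Δ)`, `((1+Δ)/2)·(M²/2)(M²/2+1) ≤ Re⟨ψ, S⁺_tot S⁻_tot ψ⟩`. -/
private theorem small_of_cases
    (h : ∀ (M : ℕ) [NeZero M], M = 4 ∨ M = 6 ∨ M = 8 → ∀ Δ ∈ Set.Ioo (0:ℝ) 1,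
      ∀ (ψ : TensorIndex (TorusSite 2 M) 2 → ℂ),
      ψ ∈ spinZSector (Λ := TorusSite 2 M) 1 0 → star ψ ⬝ᵥ ψ = 1 →
      Matrix.mulVec (xxzHamiltonian 1 (torusGraph 2 M) (-1) Δ) ψ =
        ((lowestEnergyInSector 1 (xxzHamiltonian 1 (torusGraph 2 M) (-1) Δ) 0 : ℝ) : ℂ) • ψ →
      (1 + Δ) / 2 * ((M : ℝ) ^ 2 / 2 * ((M : ℝ) ^ 2 / 2 + 1)) ≤
        (star ψ ⬝ᵥ Matrix.mulVec ((∑ x : TorusSite 2 M, onSite x (spinRaise 1)) *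
          (∑ y : TorusSite 2 M, onSite y (spinLower 1))) ψ).re) :
    FerroSideChordSmall := by
  intro M _ hE h4 h8 Δ hΔ ψ hmem hψ1 heig
  have hM : M = 4 ∨ M = 6 ∨ M = 8 := by
    obtain ⟨k, hk⟩ := hE
    omega
  exact h M hM Δ hΔ ψ hmem hψ1 heig

/-- **`FerroSideChordSmall` from `M = 6` and `M = 8` alone** (`M = 4` is the kernel-certified
`FourTorus.ferroSideChord_four`, valid on all of `[0,1]`). [folklore] -/
theorem ferroSideChordSmall_of_six_eight
    (h6 : ∀ Δ ∈ Set.Ioo (0:ℝ) 1, ∀ (ψ : TensorIndex (TorusSite 2 6) 2 → ℂ),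
      ψ ∈ spinZSector (Λ := TorusSite 2 6) 1 0 → star ψ ⬝ᵥ ψ = 1 →
      Matrix.mulVec (xxzHamiltonian 1 (torusGraph 2 6) (-1) Δ) ψ =
        ((lowestEnergyInSector 1 (xxzHamiltonian 1 (torusGraph 2 6) (-1) Δ) 0 : ℝ) : ℂ) • ψ →
      (1 + Δ) / 2 * (((6 : ℕ) : ℝ) ^ 2 / 2 * (((6 : ℕ) : ℝ) ^ 2 / 2 + 1)) ≤
        (star ψ ⬝ᵥ Matrix.mulVec ((∑ x : TorusSite 2 6, onSite x (spinRaise 1)) *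
          (∑ y : TorusSite 2 6, onSite y (spinLower 1))) ψ).re)
    (h8 : ∀ Δ ∈ Set.Ioo (0:ℝ) 1, ∀ (ψ : TensorIndex (TorusSite 2 8) 2 → ℂ),
      ψ ∈ spinZSector (Λ := TorusSite 2 8) 1 0 → star ψ ⬝ᵥ ψ = 1 →
      Matrix.mulVec (xxzHamiltonian 1 (torusGraph 2 8) (-1) Δ) ψ =
        ((lowestEnergyInSector 1 (xxzHamiltonian 1 (torusGraph 2 8) (-1) Δ) 0 : ℝ) : ℂ) • ψ →
      (1 + Δ) / 2 * (((8 : ℕ) : ℝ) ^ 2 / 2 * (((8 : ℕ) : ℝ) ^ 2 / 2 + 1)) ≤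
        (star ψ ⬝ᵥ Matrix.mulVec ((∑ x : TorusSite 2 8, onSite x (spinRaise 1)) *
          (∑ y : TorusSite 2 8, onSite y (spinLower 1))) ψ).re) :
    FerroSideChordSmall := by
  refine small_of_cases fun M _ hM => ?_
  rcases hM with rfl | rfl | rfl
  · intro Δ hΔ ψ hmem hψ1 heig
    exact ferroSideChord_four Δ ⟨hΔ.1.le, hΔ.2.le⟩ ψ hmem hψ1 heig
  · exact h6
  · exact h8

/-- **What remains of the crux `FerroSideChord` (stmt-19089) after piece C:** piece A
`FerroSideChordLarge` (stmt-23918: even `M ≥ 10`, `Δ ∈ (0,1)`) together with the interior chord at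
`M = 6` and at `M = 8` gives the crux on all of `[0,1]` for every even `M ≥ 4` (`M = 4` certified,
endpoints by continuity, glue by logic). [folklore] -/
theorem ferroSideChord_of_large_six_eight (hA : FerroSideChordLarge)
    (h6 : ∀ Δ ∈ Set.Ioo (0:ℝ) 1, ∀ (ψ : TensorIndex (TorusSite 2 6) 2 → ℂ),
      ψ ∈ spinZSector (Λ := TorusSite 2 6) 1 0 → star ψ ⬝ᵥ ψ = 1 →
      Matrix.mulVec (xxzHamiltonian 1 (torusGraph 2 6) (-1) Δ) ψ =
        ((lowestEnergyInSector 1 (xxzHamiltonian 1 (torusGraph 2 6) (-1) Δ) 0 : ℝ) : ℂ) • ψ →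
      (1 + Δ) / 2 * (((6 : ℕ) : ℝ) ^ 2 / 2 * (((6 : ℕ) : ℝ) ^ 2 / 2 + 1)) ≤
        (star ψ ⬝ᵥ Matrix.mulVec ((∑ x : TorusSite 2 6, onSite x (spinRaise 1)) *
          (∑ y : TorusSite 2 6, onSite y (spinLower 1))) ψ).re)
    (h8 : ∀ Δ ∈ Set.Ioo (0:ℝ) 1, ∀ (ψ : TensorIndex (TorusSite 2 8) 2 → ℂ),
      ψ ∈ spinZSector (Λ := TorusSite 2 8) 1 0 → star ψ ⬝ᵥ ψ = 1 →
      Matrix.mulVec (xxzHamiltonian 1 (torusGraph 2 8) (-1) Δ) ψ =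
        ((lowestEnergyInSector 1 (xxzHamiltonian 1 (torusGraph 2 8) (-1) Δ) 0 : ℝ) : ℂ) • ψ →
      (1 + Δ) / 2 * (((8 : ℕ) : ℝ) ^ 2 / 2 * (((8 : ℕ) : ℝ) ^ 2 / 2 + 1)) ≤
        (star ψ ⬝ᵥ Matrix.mulVec ((∑ x : TorusSite 2 8, onSite x (spinRaise 1)) *
          (∑ y : TorusSite 2 8, onSite y (spinLower 1))) ψ).re) :
    FerroSideChord :=
  ferroSideChord_of_large_small hA (ferroSideChordSmall_of_six_eight h6 h8)

end Summit.HubbardSuperconductivity.HubbardSuperconductivity.Theorems.AnisotropyChord.FerroSide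

end
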